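import Summits.AtomisticToContinuum.Crystallization.Theses.PalmUnimodularRigidity
import Summits.AtomisticToContinuum.Crystallization.Theorems.DefectFreeCrystallizes.Negative.PredicateAPI
import Literature.Probability.Process.PointStationaryLaw

/-!
# Route-posited vocabulary of line `palm-good-law` for crux `ReggeStarCoercivity.DefectFreeCrystallizes`
# (item stmt-AtomisticToContinuum-13603) — definitions only

The crux `DefectFreeCrystallizes` is `ZeroDefectDensity → IsCrystallizing lennardJones 3`
(`PredicateAPI.defectFreeCrystallizes_iff` is `Iff.rfl`). Line `palm-good-law` (crux-strategist gen 1,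
reshaped by lead c1) transfers the crux to the stationary / Palm sibling (route `PalmUnimodularRigidity`)
and back:

* P1 `GoodLawOfZeroDefects` — along a ground-state sequence with defect fraction `→ 0`, some
  Benjamini–Schramm limit law (the clauses of item 9230 verbatim, packaged as `GoodLimitLaw`) is almost
  surely carried by configurations ALL of whose points are `SetGood` (the crux's `Good` read on an infinite
  configuration with the OPEN outer cutoff `6/5` — the closure of `Good` under local limits of separated
  configurations, cf. `PredicateAPI.good_not_closed`);
* P3a `FunnelToShells` — a MINIMISING point-stationary hard-core law almost surely carried by
  everywhere-`SetGood` configurations has, almost surely, a `(1/100)`-close-packed ROOT shell in the exact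
  format of item 9225 `MinimiserShells` (so P3a is `MinimiserShells` restricted to the `1/20`-funnel: the
  energy step of the line);
* P2' = item 9227 `ShellsToBarlowChart` and P4 = item 9226 `LayeredLawsSelectHcp`, both BY NAME;
* P5 `ChargeFromLaw` — the bookkeeping implication back to the finite-`N` hinge
  `GroundStatesChargePeriodic` (item 2911's statement), after which the PROVED
  `chargedPatternCrystallizes_proof` (item 2916) and `LennardJonesMinimalDistance_holds` conclude the crux.

This file only DEFINES the statement blocks (every stub of the line is a theorem `stub_x : <one of these
names>` landed in its own `Theorems/` file); the one theorem here is the definitional unfolding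
`setGood_iff` (the file's anchor). Nothing in this file is a published fact: all `def … : Prop` below are
objects the route posits (D-0016 `<RouteSlug>Defs` convention), not literature debt.
-/

noncomputable section

open scoped BigOperators ENNReal
open Filter Topology MeasureTheory

namespace Summit.AtomisticToContinuum.Crystallization.Theorems.PalmGoodLaw

open Summit.AtomisticToContinuum.Crystallization.Theses
open Summit.AtomisticToContinuum.Crystallization.Theorems.DefectFreeCrystallizes.Negative.PredicateAPI
open Literature.MathematicalPhysics.StatisticalMechanics Literature.Geometry.DiscreteGeometry
open Literature.Probability.Process

/-- **Limit-stable goodness of a point `y` of a point set `S`** (the crux's finite-`N` predicate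
`PredicateAPI.Good`, read on an infinite configuration with the OPEN outer cutoff): for some admissible
scale `a ∈ [9/10, 11/10]` the recentred, rescaled set of the other points of `S` in the OPEN ball of radius
`6/5` about `y` is a finite set `1/20`-close, after a linear isometry, to the fcc or the hcp kissing
pattern. Finite-`N` `Good` sites are `SetGood` (radial pinning keeps the twelve matched points at distance
`≤ 21a/20 < 6/5`), and unlike `Good` the predicate is closed under local limits of separated
configurations (extra points may only arrive ON the sphere of radius `6/5`). Route-posited object of line
`palm-good-law` (crux stmt-AtomisticToContinuum-13603). -/
def SetGood (S : Set (EuclideanSpace ℝ (Fin 3))) (y : EuclideanSpace ℝ (Fin 3)) : Prop :=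
  ∃ a : ℝ, 9 / 10 ≤ a ∧ a ≤ 11 / 10 ∧ ∃ T : Finset (EuclideanSpace ℝ (Fin 3)),
    (↑T : Set (EuclideanSpace ℝ (Fin 3))) =
      (fun z : EuclideanSpace ℝ (Fin 3) => a⁻¹ • (z - y)) ''
        {z : EuclideanSpace ℝ (Fin 3) | z ∈ S ∧ z ≠ y ∧ dist z y < 6 / 5} ∧
    (ShellCloseTo (1 / 20) T fccKissingPattern ∨ ShellCloseTo (1 / 20) T hcpKissingPattern)

/-- Definitional unfolding of `SetGood` (anchor of this definitions file). -/
theorem setGood_iff : ∀ (S : Set (EuclideanSpace ℝ (Fin 3))) (y : EuclideanSpace ℝ (Fin 3)), SetGood S y ↔ ∃ a : ℝ, 9 / 10 ≤ a ∧ a ≤ 11 / 10 ∧ ∃ T : Finset (EuclideanSpace ℝ (Fin 3)), (↑T : Set (EuclideanSpace ℝ (Fin 3))) = (fun z : EuclideanSpace ℝ (Fin 3) => a⁻¹ • (z - y)) '' {z : EuclideanSpace ℝ (Fin 3) | z ∈ S ∧ z ≠ y ∧ dist z y < 6 / 5} ∧ (ShellCloseTo (1 / 20) T fccKissingPattern ∨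 ShellCloseTo (1 / 20) T hcpKissingPattern) :=
  fun _ _ => Iff.rfl

/-- The crux's antecedent read for ONE sequence of configurations: the fraction of `1/20`-defective
first shells (`PredicateAPI.defects`, verbatim the crux's sub-expression) tends to `0`. Route-posited
object of line `palm-good-law` (crux stmt-AtomisticToContinuum-13603). -/
def ZeroDefectsAlong (x : (N : ℕ) → (Fin N → EuclideanSpace ℝ (Fin 3))) : Prop :=
  Tendsto (fun N : ℕ => (defects (x N) : ℝ) / N) atTop (𝓝 0)

/-- **Good Benjamini–Schramm limit law of the sequence `x` along `φ`**: the clauses of the PROVED item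
9230 `PalmUnimodularRigidity.BenjaminiSchrammLimit` for `(x, φ, δ, P)` — hard core, Mecke / mass-transport
identity, energy identity, density transfer (verbatim) — plus: `P`-almost every configuration is the
counting measure of a set ALL of whose points are `SetGood`. Route-posited object of line `palm-good-law`
(crux stmt-AtomisticToContinuum-13603). -/
def GoodLimitLaw (x : (N : ℕ) → (Fin N → EuclideanSpace ℝ (Fin 3))) (φ : ℕ → ℕ) (δ : ℝ)
    (P : Measure (Measure (EuclideanSpace ℝ (Fin 3)))) : Prop :=
  StrictMono φ ∧ 0 < δ ∧ IsProbabilityMeasure P ∧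
  (∀ᵐ μ ∂P, IsRootedHardCore δ μ) ∧ IsPointStationaryLaw P ∧
  Tendsto (fun j : ℕ => groundStateEnergy lennardJones 3 (φ j) / (φ j : ℝ)) atTop
    (𝓝 (∫ μ, (∫ y, lennardJones ‖y‖ ∂μ) / 2 ∂P)) ∧
  (∀ T : Set (Measure (EuclideanSpace ℝ (Fin 3))), ∀ R ε : ℝ, 0 < ε → ∀ ρ : ℝ, ρ < (P T).toReal →
    ∀ᶠ j : ℕ in atTop,
      ρ * (φ j : ℝ) ≤ (Nat.card {i : Fin (φ j) // ∃ ν ∈ T,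
        ((∀ p : EuclideanSpace ℝ (Fin 3), ν {p} ≠ 0 → ‖p‖ ≤ R →
            ∃ q ∈ (Set.range (fun k : Fin (φ j) => x (φ j) k - x (φ j) i)), dist q p ≤ ε) ∧
         (∀ q ∈ (Set.range (fun k : Fin (φ j) => x (φ j) k - x (φ j) i)), ‖q‖ ≤ R →
            ∃ p : EuclideanSpace ℝ (Fin 3), ν {p} ≠ 0 ∧ dist q p ≤ ε))} : ℝ)) ∧
  (∀ᵐ μ ∂P, ∃ S : Set (EuclideanSpace ℝ (Fin 3)),
    μ = (Measure.count : Measure (EuclideanSpace ℝ (Fin 3))).restrict S ∧ ∀ y ∈ S, SetGood S y)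

/-- **P1 — good limit law.** For every sequence of Lennard-Jones ground states along which the defect
fraction tends to `0`, some Benjamini–Schramm limit law is carried by configurations all of whose points
are `SetGood`. Intended proof: for `0 < η ≤ 1/50` let `T_η` be the configurations whose root is NOT good
at tolerance `1/20 + η` with the shell read in the open ball of radius `6/5 − η`; a `Good` particle
`(2, ε)`-matched to `ν` (`ε ≤ η/4`, `ε` below half the hard cores) forces `ν ∉ T_η`, so `P(T_η) > 0` would
give, by the density-transfer clause of 9230, eventually `≥ ρ·φ(j)` defective particles — against
`defects/φ(j) → 0`; `η ↓ 0` by local finiteness + compactness of `[9/10, 11/10] × O(3) × {bijections}`;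
"root a.s. ⇒ every point a.s." by the PROVED `ae_forall_map_sub_of_ae`. Route-posited statement of line
`palm-good-law` (crux stmt-AtomisticToContinuum-13603), stub `stub_goodLaw`. -/
def GoodLawOfZeroDefects : Prop :=
  ∀ x : (N : ℕ) → (Fin N → EuclideanSpace ℝ (Fin 3)), (∀ N, IsGroundState lennardJones (x N)) →
    ZeroDefectsAlong x →
      ∃ (φ : ℕ → ℕ) (δ : ℝ) (P : Measure (Measure (EuclideanSpace ℝ (Fin 3)))), GoodLimitLaw x φ δ P

/-- **P3a — FUNNEL ⇒ SHELLS in mean (the line's energy step; hardest own stub).** A point-stationary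
probability law on rooted `δ`-hard-core configurations with `E_P[h] ≤ e* := ⨅ periodic e(Q)` which is
almost surely carried by configurations all of whose points are `SetGood` (the `1/20`-funnel) has, almost
surely, a `(1/100)`-close-packed ROOT shell at a scale `a ∈ [9/10, 1]` read in the closed ball of radius
`5a/4` — VERBATIM the conclusion of item 9225 `PalmUnimodularRigidity.MinimiserShells`, so that this is
`MinimiserShells` restricted to the funnel (strictly weaker than 9225; its content is the energetic
exactification of strain, shape and scale inside the funnel, where exact minimality `E_P[h] = e*` is
spent). Route-posited statement of line `palm-good-law` (crux stmt-AtomisticToContinuum-13603), stub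
`stub_funnelToShells`. -/
def FunnelToShells : Prop :=
  ∀ δ : ℝ, 0 < δ → ∀ P : Measure (Measure (EuclideanSpace ℝ (Fin 3))), IsProbabilityMeasure P →
    (∀ᵐ μ ∂P, IsRootedHardCore δ μ) → IsPointStationaryLaw P →
    (∫ μ, (∫ y, lennardJones ‖y‖ ∂μ) / 2 ∂P) ≤
      (⨅ Q : PeriodicConfiguration 3, Q.energyPerParticle lennardJones) →
    (∀ᵐ μ ∂P, ∃ S : Set (EuclideanSpace ℝ (Fin 3)),
      μ = (Measure.count : Measure (EuclideanSpace ℝ (Fin 3))).restrict S ∧ ∀ y ∈ S, SetGood S y) →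
    ∀ᵐ μ ∂P, ∃ a : ℝ, 9 / 10 ≤ a ∧ a ≤ 1 ∧ ∃ T : Finset (EuclideanSpace ℝ (Fin 3)),
      (↑T : Set (EuclideanSpace ℝ (Fin 3))) =
        {y : EuclideanSpace ℝ (Fin 3) | μ {y} ≠ 0 ∧ y ≠ 0 ∧ ‖y‖ ≤ 5 / 4 * a} ∧
      (ShellCloseTo (a / 100) T
          (Finset.image (fun v : EuclideanSpace ℝ (Fin 3) => a • v) fccKissingPattern) ∨
        ShellCloseTo (a / 100) T
          (Finset.image (fun v : EuclideanSpace ℝ (Fin 3) => a • v) hcpKissingPattern))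

/-- **P5 — charging one periodic configuration from the law** (item 9231 `PalmToHinge` relativised to
good laws, composed with item 9228 `CruxesToPalmRigidity`'s root-to-every-point step). Under the crux's
antecedent every ground-state sequence has a good limit law (P1), minimising by `CrysEnergyLimit_holds`;
P3a gives the root shell, `ae_forall_map_sub_of_ae` every shell, 9227 the global Barlow chart, 9226 the
a.s. rotated relaxed hcp crystal with `(a, h)` in the compact box `[1/2, 2]²`;
`exists_mem_forall_nhds_measure_ne_zero` gives a support point `(a₀, h₀)`, `matched_hcp_of_matched_near`
turns nearby parameters into `(R, ε/2)`-close crystals, and the density-transfer clause yields `≥ ρ N`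
particles charged by `hcpPeriodicConfiguration a₀ h₀` at base point `0`, eventually along `φ` hence
frequently in `N`: item 2911's statement `GroundStatesChargePeriodic`. Route-posited statement of line
`palm-good-law` (crux stmt-AtomisticToContinuum-13603), stub `stub_chargeFromLaw`. -/
def ChargeFromLaw : Prop :=
  GoodLawOfZeroDefects → FunnelToShells → PalmUnimodularRigidity.ShellsToBarlowChart →
    PalmUnimodularRigidity.LayeredLawsSelectHcp →
    (∀ x : (N : ℕ) → (Fin N → EuclideanSpace ℝ (Fin 3)), (∀ N, IsGroundState lennardJones (x N)) →
      ZeroDefectsAlong x) →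
    PalmUnimodularRigidity.GroundStatesChargePeriodic

end Summit.AtomisticToContinuum.Crystallization.Theorems.PalmGoodLaw

end
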